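import Summits.NavierStokesRegularity.NavierStokesRegularity.Theorems.PoloidalWindowDoorPoloidalWindowRigidityZShockRotatingProfileRiemannLaw
import HarnessLib

/-!
# Crux K2 `PoloidalWindowRigidity` (stmt-NavierStokesRegularity-19708), line `z_shock` — R3 inhabitant census: ROTATING PATTERNS (XVII) —
# the Riemann law ALONG AN OUTGOING CHARACTERISTIC CURVE: chain rule along `Y' = Y ∓ (λ/γ(Ψ)) JY` composed with the pointwise
# Riemann law of part XVI, and the twin law of the incoming invariant `w₋` (census item F3b)

`--supports stmt-NavierStokesRegularity-19708 --as helper` (leafhand-ns-poloidalwindowdoor-3 g10, cell decomp-ns, 2026-08-31).  Class-free,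
def-free; parts XIII (`…RotatingProfileRiemann`), XIV (`…RotatingProfileRiemannSource`), XVI (`…RotatingProfileRiemannLaw`) + Mathlib.
**No stub and no summit is closed by this file; Navier–Stokes regularity is NOT proved here (rung 0).**

WHY THIS FILE.  Part XVI states the transport of John's outgoing approximate Riemann invariant
`w₊ = γ(Ψ)XΨ + λΘΨ` (`λ = √((ω²|y|² − γ(Ψ))γ(Ψ))`) of a rotating profile POINTWISE, as the value of the first-order operator
`X − (λ/γ(Ψ))Θ` applied to `w₊` (`X = y·∇`, `Θ = Jy·∇`).  Census item F4 (the forced one-sided Riccati kernel `…ZShockRiccatiForced`)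
needs it as an ODE along a CURVE.  The integral curves of `X − (λ/γ(Ψ))Θ` in the log-radius parametrisation are the solutions
`Y : ℝ → ℝ²` of `Y'(ρ) = Y(ρ) − (λ/γ(Ψ))(Y(ρ)) · J(Y(ρ))` (their existence for all forward log-radii is part XVIII,
`…RotatingProfileCharacteristics`); this file supplies the composition:

* `hasDerivAt_comp_characteristic` — chain rule: for `f : ℝ² → ℝ` differentiable at `Y ρ` and `Y'(ρ) = Y ρ − c·J(Y ρ)`,
  `(f ∘ Y)'(ρ) = Xf(Y ρ) − c·Θf(Y ρ)` (both as `fderiv`s at the point);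
* `differentiableAt_outgoing` / `differentiableAt_incoming` — `w₊`, `w₋` are differentiable at every point of the hyperbolic exterior
  (`γ(Ψ(y)) < ω²|y|²`, where `λ` is the square root of a positive quantity);
* ★ `riemann_law_along_characteristic` — if `Y'(ρ) = Y ρ − (λ/γ(Ψ))(Y ρ)·J(Y ρ)` and `Y ρ` is exterior, then `ρ ↦ w₊(Y ρ)` has at `ρ` the
  derivative `−(g/4)(1/λ² + 1/γ²)·w₊² + (g/(2λ²))·w₊w₋ − (g/4)(1/λ² − 1/γ²)·w₋² + ((Xλ − λΘλ/γ)/(2λ))·(w₊ − w₋)` (all at `Y ρ`, `g = γ'(Ψ)`):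
  the forced Riccati law of census item F4 with the self-interaction coefficient of the THICK sign;
* ★ `rotating_riemann_law_neg` / `riemann_law_neg_along_characteristic` — the twin law for `w₋ = γ(Ψ)XΨ − λΘΨ` along
  `Y' = Y + (λ/γ(Ψ))JY`: `−(g/4)(1/λ² + 1/γ²)·w₋² + (g/(2λ²))·w₋w₊ − (g/4)(1/λ² − 1/γ²)·w₊² + ((Xλ + λΘλ/γ)/(2λ))·(w₋ − w₊)`
  (part XIV's `source_in_invariants` at `(−λ, −Xλ, −Θλ)`).

Elementary (chain rule + the landed identities); no estimate and no rigidity is proved here: what F4 still needs is the John normalisation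
(`∫ (coefficient of w₊²) dρ = ∞` from thickness, integrable cross/geometric forcing) and the circle datum (parts IX–XI). [folklore]
(John 1974 §2; Hörmander 1997 §4.2)
-/

noncomputable section

namespace Summit.NavierStokesRegularity.NavierStokesRegularity.Theorems.PoloidalWindowDoorPoloidalWindowRigidityZShockRotatingProfileCharacteristicLaw

-- the summit and its single sub-problem share the name (CONVENTIONS §1)
set_option linter.dupNamespace false

open Set Filter Topology
open Summit.NavierStokesRegularity.NavierStokesRegularity.Theorems.PoloidalWindowDoorPoloidalWindowRigidityZShockRotatingProfileRiemann Summit.NavierStokesRegularity.NavierStokesRegularity.Theorems.PoloidalWindowDoorPoloidalWindowRigidityZShockRotatingProfileRiemannSource Summit.NavierStokesRegularity.NavierStokesRegularity.Theorems.PoloidalWindowDoorPoloidalWindowRigidityZShockRotatingProfileRiemannLaw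

variable {Ψ : EuclideanSpace ℝ (Fin 2) → ℝ} {γ γ' : ℝ → ℝ} {J : EuclideanSpace ℝ (Fin 2) → EuclideanSpace ℝ (Fin 2)} {ω : ℝ}
  {Y : ℝ → EuclideanSpace ℝ (Fin 2)}

/-! ### Chain rule along a characteristic curve -/

/-- **Chain rule along a characteristic curve.**  If `Y'(ρ) = Y ρ − c·J(Y ρ)` and `f` is differentiable at `Y ρ`, then
`(f ∘ Y)'(ρ) = Df(Y ρ)[Y ρ] − c·Df(Y ρ)[J(Y ρ)] = (Xf − cΘf)(Y ρ)`. [folklore] -/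
theorem hasDerivAt_comp_characteristic {f : EuclideanSpace ℝ (Fin 2) → ℝ} {ρ c : ℝ}
    (hf : DifferentiableAt ℝ f (Y ρ)) (hY : HasDerivAt Y (Y ρ - c • J (Y ρ)) ρ) :
    HasDerivAt (fun ρ' => f (Y ρ')) (fderiv ℝ f (Y ρ) (Y ρ) - c * fderiv ℝ f (Y ρ) (J (Y ρ))) ρ := by
  have h := hf.hasFDerivAt.comp_hasDerivAt ρ hY
  rw [map_sub, map_smul, smul_eq_mul] at h
  exact h

/-- **Chain rule along an incoming characteristic curve** (`Y'(ρ) = Y ρ + c·J(Y ρ)`):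
`(f ∘ Y)'(ρ) = Df(Y ρ)[Y ρ] + c·Df(Y ρ)[J(Y ρ)]`. [folklore] -/
theorem hasDerivAt_comp_characteristic_neg {f : EuclideanSpace ℝ (Fin 2) → ℝ} {ρ c : ℝ}
    (hf : DifferentiableAt ℝ f (Y ρ)) (hY : HasDerivAt Y (Y ρ + c • J (Y ρ)) ρ) :
    HasDerivAt (fun ρ' => f (Y ρ')) (fderiv ℝ f (Y ρ) (Y ρ) + c * fderiv ℝ f (Y ρ) (J (Y ρ))) ρ := by
  have h := hf.hasFDerivAt.comp_hasDerivAt ρ hY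
  rw [map_add, map_smul, smul_eq_mul] at h
  exact h

/-! ### Differentiability of the approximate Riemann invariants in the exterior -/

/-- The outgoing invariant `w₊ = γ(Ψ)XΨ + λΘΨ` is differentiable at every exterior point. [folklore] -/
theorem differentiableAt_outgoing (hΨ : ContDiff ℝ 2 Ψ) (hγ : ContDiff ℝ 1 γ)
    (hJ : ∀ y' : EuclideanSpace ℝ (Fin 2), J y' = (-(y' 1)) • EuclideanSpace.single (0 : Fin 2) (1 : ℝ) +
      (y' 0) • EuclideanSpace.single (1 : Fin 2) (1 : ℝ))
    (hγpos : ∀ r, 0 < γ r) (y : EuclideanSpace ℝ (Fin 2)) (hext : γ (Ψ y) < ω ^ 2 * ‖y‖ ^ 2) :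
    DifferentiableAt ℝ (fun y' : EuclideanSpace ℝ (Fin 2) => γ (Ψ y') * fderiv ℝ Ψ y' y' +
      Real.sqrt ((ω ^ 2 * ‖y'‖ ^ 2 - γ (Ψ y')) * γ (Ψ y')) * fderiv ℝ Ψ y' (J y')) y := by
  have hJ' : J = fun y' => (-(y' 1)) • EuclideanSpace.single (0 : Fin 2) (1 : ℝ) +
      (y' 0) • EuclideanSpace.single (1 : Fin 2) (1 : ℝ) := funext hJ
  have hJc : ContDiff ℝ 1 J := by rw [hJ']; fun_prop
  have hΨd : Differentiable ℝ Ψ := hΨ.differentiable two_ne_zero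
  have hDΨ : ContDiff ℝ 1 (fderiv ℝ Ψ) := hΨ.fderiv_right (m := 1) le_rfl
  have hqd : Differentiable ℝ fun y' => fderiv ℝ Ψ y' (J y') := (hDΨ.clm_apply hJc).differentiable one_ne_zero
  have hXd : Differentiable ℝ fun y' => fderiv ℝ Ψ y' y' := (hDΨ.clm_apply contDiff_id).differentiable one_ne_zero
  have hγΨd : Differentiable ℝ fun y' => γ (Ψ y') := (hγ.differentiable one_ne_zero).comp hΨd
  have hnd : Differentiable ℝ fun x' : EuclideanSpace ℝ (Fin 2) => ‖x'‖ ^ 2 :=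
    (contDiff_norm_sq ℝ (n := 1)).differentiable one_ne_zero
  have hmd : Differentiable ℝ fun y' : EuclideanSpace ℝ (Fin 2) => ω ^ 2 * ‖y'‖ ^ 2 - γ (Ψ y') := (hnd.const_mul _).sub hγΨd
  have hpos : 0 < (ω ^ 2 * ‖y‖ ^ 2 - γ (Ψ y)) * γ (Ψ y) := mul_pos (sub_pos.2 hext) (hγpos _)
  have hlamd : DifferentiableAt ℝ (fun y' : EuclideanSpace ℝ (Fin 2) => Real.sqrt ((ω ^ 2 * ‖y'‖ ^ 2 - γ (Ψ y')) * γ (Ψ y'))) y :=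
    ((hmd.mul hγΨd) y).sqrt hpos.ne'
  exact ((hγΨd.mul hXd) y).add (hlamd.mul (hqd y))

/-- The incoming invariant `w₋ = γ(Ψ)XΨ − λΘΨ` is differentiable at every exterior point. [folklore] -/
theorem differentiableAt_incoming (hΨ : ContDiff ℝ 2 Ψ) (hγ : ContDiff ℝ 1 γ)
    (hJ : ∀ y' : EuclideanSpace ℝ (Fin 2), J y' = (-(y' 1)) • EuclideanSpace.single (0 : Fin 2) (1 : ℝ) +
      (y' 0) • EuclideanSpace.single (1 : Fin 2) (1 : ℝ))
    (hγpos : ∀ r, 0 < γ r) (y : EuclideanSpace ℝ (Fin 2)) (hext : γ (Ψ y) < ω ^ 2 * ‖y‖ ^ 2) :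
    DifferentiableAt ℝ (fun y' : EuclideanSpace ℝ (Fin 2) => γ (Ψ y') * fderiv ℝ Ψ y' y' -
      Real.sqrt ((ω ^ 2 * ‖y'‖ ^ 2 - γ (Ψ y')) * γ (Ψ y')) * fderiv ℝ Ψ y' (J y')) y := by
  have hJ' : J = fun y' => (-(y' 1)) • EuclideanSpace.single (0 : Fin 2) (1 : ℝ) +
      (y' 0) • EuclideanSpace.single (1 : Fin 2) (1 : ℝ) := funext hJ
  have hJc : ContDiff ℝ 1 J := by rw [hJ']; fun_prop
  have hΨd : Differentiable ℝ Ψ := hΨ.differentiable two_ne_zero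
  have hDΨ : ContDiff ℝ 1 (fderiv ℝ Ψ) := hΨ.fderiv_right (m := 1) le_rfl
  have hqd : Differentiable ℝ fun y' => fderiv ℝ Ψ y' (J y') := (hDΨ.clm_apply hJc).differentiable one_ne_zero
  have hXd : Differentiable ℝ fun y' => fderiv ℝ Ψ y' y' := (hDΨ.clm_apply contDiff_id).differentiable one_ne_zero
  have hγΨd : Differentiable ℝ fun y' => γ (Ψ y') := (hγ.differentiable one_ne_zero).comp hΨd
  have hnd : Differentiable ℝ fun x' : EuclideanSpace ℝ (Fin 2) => ‖x'‖ ^ 2 :=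
    (contDiff_norm_sq ℝ (n := 1)).differentiable one_ne_zero
  have hmd : Differentiable ℝ fun y' : EuclideanSpace ℝ (Fin 2) => ω ^ 2 * ‖y'‖ ^ 2 - γ (Ψ y') := (hnd.const_mul _).sub hγΨd
  have hpos : 0 < (ω ^ 2 * ‖y‖ ^ 2 - γ (Ψ y)) * γ (Ψ y) := mul_pos (sub_pos.2 hext) (hγpos _)
  have hlamd : DifferentiableAt ℝ (fun y' : EuclideanSpace ℝ (Fin 2) => Real.sqrt ((ω ^ 2 * ‖y'‖ ^ 2 - γ (Ψ y')) * γ (Ψ y'))) y :=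
    ((hmd.mul hγΨd) y).sqrt hpos.ne'
  exact ((hγΨd.mul hXd) y).sub (hlamd.mul (hqd y))

/-! ### The Riemann law along an outgoing characteristic -/

/-- ★ **The Riemann law along an outgoing characteristic.**  Let `Ψ` be a `C²` solution of the rotating-profile equation
`ω² ΘΘΨ = Σᵢ∂ᵢ(γ(Ψ)∂ᵢΨ)` with `γ ∈ C¹`, `γ > 0`, `γ'` the derivative of `γ`, and let `Y` satisfy at `ρ` the outgoing characteristic
equation `Y'(ρ) = Y ρ − (λ/γ(Ψ))(Y ρ)·J(Y ρ)` with `Y ρ` in the hyperbolic exterior.  Then `ρ' ↦ w₊(Y ρ')` has at `ρ` the derivative given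
by the quadratic form of part XVI evaluated at `y = Y ρ`. [folklore] -/
theorem riemann_law_along_characteristic (hΨ : ContDiff ℝ 2 Ψ) (hγ : ContDiff ℝ 1 γ) (hγ' : ∀ r, HasDerivAt γ (γ' r) r)
    (hJ : ∀ y' : EuclideanSpace ℝ (Fin 2), J y' = (-(y' 1)) • EuclideanSpace.single (0 : Fin 2) (1 : ℝ) +
      (y' 0) • EuclideanSpace.single (1 : Fin 2) (1 : ℝ))
    (hrot : ∀ y : EuclideanSpace ℝ (Fin 2),
      ω ^ 2 * fderiv ℝ (fun y' => fderiv ℝ Ψ y' (J y')) y (J y) =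
        ∑ i, fderiv ℝ (fun y' => γ (Ψ y') * fderiv ℝ Ψ y' (EuclideanSpace.single i 1)) y (EuclideanSpace.single i 1))
    (hγpos : ∀ r, 0 < γ r) {ρ : ℝ}
    (hY : HasDerivAt Y (Y ρ - (Real.sqrt ((ω ^ 2 * ‖Y ρ‖ ^ 2 - γ (Ψ (Y ρ))) * γ (Ψ (Y ρ))) / γ (Ψ (Y ρ))) • J (Y ρ)) ρ)
    (hext : γ (Ψ (Y ρ)) < ω ^ 2 * ‖Y ρ‖ ^ 2) :
    HasDerivAt (fun ρ' => (fun y' : EuclideanSpace ℝ (Fin 2) => γ (Ψ y') * fderiv ℝ Ψ y' y' +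
        Real.sqrt ((ω ^ 2 * ‖y'‖ ^ 2 - γ (Ψ y')) * γ (Ψ y')) * fderiv ℝ Ψ y' (J y')) (Y ρ'))
      (-(γ' (Ψ (Y ρ)) / 4 * (1 / Real.sqrt ((ω ^ 2 * ‖Y ρ‖ ^ 2 - γ (Ψ (Y ρ))) * γ (Ψ (Y ρ))) ^ 2 + 1 / γ (Ψ (Y ρ)) ^ 2)) * ((γ (Ψ (Y ρ)) * fderiv ℝ Ψ (Y ρ) (Y ρ)) + Real.sqrt ((ω ^ 2 * ‖Y ρ‖ ^ 2 - γ (Ψ (Y ρ))) * γ (Ψ (Y ρ))) * fderiv ℝ Ψ (Y ρ) (J (Y ρ))) ^ 2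
        + γ' (Ψ (Y ρ)) / (2 * Real.sqrt ((ω ^ 2 * ‖Y ρ‖ ^ 2 - γ (Ψ (Y ρ))) * γ (Ψ (Y ρ))) ^ 2) * (((γ (Ψ (Y ρ)) * fderiv ℝ Ψ (Y ρ) (Y ρ)) + Real.sqrt ((ω ^ 2 * ‖Y ρ‖ ^ 2 - γ (Ψ (Y ρ))) * γ (Ψ (Y ρ))) * fderiv ℝ Ψ (Y ρ) (J (Y ρ))) * ((γ (Ψ (Y ρ)) * fderiv ℝ Ψ (Y ρ) (Y ρ)) - Real.sqrt ((ω ^ 2 * ‖Y ρ‖ ^ 2 - γ (Ψ (Y ρ))) * γ (Ψ (Y ρ))) * fderiv ℝ Ψ (Y ρ) (J (Y ρ))))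
        - γ' (Ψ (Y ρ)) / 4 * (1 / Real.sqrt ((ω ^ 2 * ‖Y ρ‖ ^ 2 - γ (Ψ (Y ρ))) * γ (Ψ (Y ρ))) ^ 2 - 1 / γ (Ψ (Y ρ)) ^ 2) * ((γ (Ψ (Y ρ)) * fderiv ℝ Ψ (Y ρ) (Y ρ)) - Real.sqrt ((ω ^ 2 * ‖Y ρ‖ ^ 2 - γ (Ψ (Y ρ))) * γ (Ψ (Y ρ))) * fderiv ℝ Ψ (Y ρ) (J (Y ρ))) ^ 2
        + (fderiv ℝ (fun y' : EuclideanSpace ℝ (Fin 2) => Real.sqrt ((ω ^ 2 * ‖y'‖ ^ 2 - γ (Ψ y')) * γ (Ψ y'))) (Y ρ) (Y ρ) - Real.sqrt ((ω ^ 2 * ‖Y ρ‖ ^ 2 - γ (Ψ (Y ρ))) * γ (Ψ (Y ρ))) * fderiv ℝ (fun y' : EuclideanSpace ℝ (Fin 2) => Real.sqrt ((ω ^ 2 * ‖y'‖ ^ 2 - γ (Ψ y')) * γ (Ψ y'))) (Y ρ) (J (Y ρ)) / γ (Ψ (Y ρ))) / (2 * Real.sqrt ((ω ^ 2 * ‖Y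 ρ‖ ^ 2 - γ (Ψ (Y ρ))) * γ (Ψ (Y ρ)))) * (((γ (Ψ (Y ρ)) * fderiv ℝ Ψ (Y ρ) (Y ρ)) + Real.sqrt ((ω ^ 2 * ‖Y ρ‖ ^ 2 - γ (Ψ (Y ρ))) * γ (Ψ (Y ρ))) * fderiv ℝ Ψ (Y ρ) (J (Y ρ))) - ((γ (Ψ (Y ρ)) * fderiv ℝ Ψ (Y ρ) (Y ρ)) - Real.sqrt ((ω ^ 2 * ‖Y ρ‖ ^ 2 - γ (Ψ (Y ρ))) * γ (Ψ (Y ρ))) * fderiv ℝ Ψ (Y ρ) (J (Y ρ)))))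
      ρ := by
  have h := hasDerivAt_comp_characteristic (differentiableAt_outgoing (ω := ω) hΨ hγ hJ hγpos (Y ρ) hext) hY
  rw [rotating_riemann_law hΨ hγ hγ' hJ hrot hγpos (Y ρ) hext] at h
  exact h

/-! ### The twin law of the incoming invariant -/

/-- ★ **The Riemann law of the incoming invariant** `w₋ = γ(Ψ)XΨ − λΘΨ` at an exterior point:
`X w₋ + (λ/γ(Ψ))Θ w₋ = −(g/4)(1/λ² + 1/γ²)·w₋² + (g/(2λ²))·w₋w₊ − (g/4)(1/λ² − 1/γ²)·w₊² + ((Xλ + λΘλ/γ)/(2λ))·(w₋ − w₊)`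
(`g = γ'(Ψ)`; part XIII's `rotating_riemann_transport_neg` + part XIV's `source_in_invariants` at `(−λ, −Xλ, −Θλ)`). [folklore] -/
theorem rotating_riemann_law_neg (hΨ : ContDiff ℝ 2 Ψ) (hγ : ContDiff ℝ 1 γ) (hγ' : ∀ r, HasDerivAt γ (γ' r) r)
    (hJ : ∀ y' : EuclideanSpace ℝ (Fin 2), J y' = (-(y' 1)) • EuclideanSpace.single (0 : Fin 2) (1 : ℝ) +
      (y' 0) • EuclideanSpace.single (1 : Fin 2) (1 : ℝ))
    (hrot : ∀ y : EuclideanSpace ℝ (Fin 2),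
      ω ^ 2 * fderiv ℝ (fun y' => fderiv ℝ Ψ y' (J y')) y (J y) =
        ∑ i, fderiv ℝ (fun y' => γ (Ψ y') * fderiv ℝ Ψ y' (EuclideanSpace.single i 1)) y (EuclideanSpace.single i 1))
    (hγpos : ∀ r, 0 < γ r) (y : EuclideanSpace ℝ (Fin 2)) (hext : γ (Ψ y) < ω ^ 2 * ‖y‖ ^ 2) :
    fderiv ℝ (fun y' : EuclideanSpace ℝ (Fin 2) => γ (Ψ y') * fderiv ℝ Ψ y' y' - Real.sqrt ((ω ^ 2 * ‖y'‖ ^ 2 - γ (Ψ y')) * γ (Ψ y')) * fderiv ℝ Ψ y' (J y')) y y + Real.sqrt ((ω ^ 2 * ‖y‖ ^ 2 - γ (Ψ y)) * γ (Ψ y)) / γ (Ψ y) * fderiv ℝ (fun y' : EuclideanSpace ℝ (Fin 2) => γ (Ψ y') * fderiv ℝ Ψ y' y' - Real.sqrt ((ω ^ 2 * ‖y'‖ ^ 2 - γ (Ψ y')) * γ (Ψ y')) * fderiv ℝ Ψ y' (J y')) y (J y) =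
      -(γ' (Ψ y) / 4 * (1 / Real.sqrt ((ω ^ 2 * ‖y‖ ^ 2 - γ (Ψ y)) * γ (Ψ y)) ^ 2 + 1 / γ (Ψ y) ^ 2)) * ((γ (Ψ y) * fderiv ℝ Ψ y y) - Real.sqrt ((ω ^ 2 * ‖y‖ ^ 2 - γ (Ψ y)) * γ (Ψ y)) * fderiv ℝ Ψ y (J y)) ^ 2
        + γ' (Ψ y) / (2 * Real.sqrt ((ω ^ 2 * ‖y‖ ^ 2 - γ (Ψ y)) * γ (Ψ y)) ^ 2) * (((γ (Ψ y) * fderiv ℝ Ψ y y) - Real.sqrt ((ω ^ 2 * ‖y‖ ^ 2 - γ (Ψ y)) * γ (Ψ y)) * fderiv ℝ Ψ y (J y)) * ((γ (Ψ y) * fderiv ℝ Ψ y y) + Real.sqrt ((ω ^ 2 * ‖y‖ ^ 2 - γ (Ψ y)) * γ (Ψ y)) * fderiv ℝ Ψ y (J y)))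
        - γ' (Ψ y) / 4 * (1 / Real.sqrt ((ω ^ 2 * ‖y‖ ^ 2 - γ (Ψ y)) * γ (Ψ y)) ^ 2 - 1 / γ (Ψ y) ^ 2) * ((γ (Ψ y) * fderiv ℝ Ψ y y) + Real.sqrt ((ω ^ 2 * ‖y‖ ^ 2 - γ (Ψ y)) * γ (Ψ y)) * fderiv ℝ Ψ y (J y)) ^ 2
        + (fderiv ℝ (fun y' : EuclideanSpace ℝ (Fin 2) => Real.sqrt ((ω ^ 2 * ‖y'‖ ^ 2 - γ (Ψ y')) * γ (Ψ y'))) y y + Real.sqrt ((ω ^ 2 * ‖y‖ ^ 2 - γ (Ψ y)) * γ (Ψ y)) * fderiv ℝ (fun y' : EuclideanSpace ℝ (Fin 2) => Real.sqrt ((ω ^ 2 * ‖y'‖ ^ 2 - γ (Ψ y')) * γ (Ψ y'))) y (J y) / γ (Ψ y)) / (2 * Real.sqrt ((ω ^ 2 * ‖y‖ ^ 2 - γ (Ψ y)) * γ (Ψ y))) * (((γ (Ψ y) * fderiv ℝ Ψ y y) - Real.sqrt ((ω ^ 2 * ‖y‖ ^ 2 - γ (Ψ y)) * γ (Ψ y))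 * fderiv ℝ Ψ y (J y)) - ((γ (Ψ y) * fderiv ℝ Ψ y y) + Real.sqrt ((ω ^ 2 * ‖y‖ ^ 2 - γ (Ψ y)) * γ (Ψ y)) * fderiv ℝ Ψ y (J y))) := by
  have hΨd : Differentiable ℝ Ψ := hΨ.differentiable two_ne_zero
  have hpos : 0 < (ω ^ 2 * ‖y‖ ^ 2 - γ (Ψ y)) * γ (Ψ y) := mul_pos (sub_pos.2 hext) (hγpos _)
  have hlam : Real.sqrt ((ω ^ 2 * ‖y‖ ^ 2 - γ (Ψ y)) * γ (Ψ y)) ≠ 0 := (Real.sqrt_pos.2 hpos).ne'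
  rw [rotating_riemann_transport_neg hΨ hγ hJ hrot hγpos y hext, rotating_angular_m (ω := ω) hΨ hγ hJ y,
    angular_chain hΨd hγ' y (J y)]
  have h := source_in_invariants (γ (Ψ y) * fderiv ℝ Ψ y y) (fderiv ℝ Ψ y (J y))
    (-Real.sqrt ((ω ^ 2 * ‖y‖ ^ 2 - γ (Ψ y)) * γ (Ψ y))) (γ (Ψ y)) (γ' (Ψ y))
    (-fderiv ℝ (fun y' : EuclideanSpace ℝ (Fin 2) => Real.sqrt ((ω ^ 2 * ‖y'‖ ^ 2 - γ (Ψ y')) * γ (Ψ y'))) y y)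
    (-fderiv ℝ (fun y' : EuclideanSpace ℝ (Fin 2) => Real.sqrt ((ω ^ 2 * ‖y'‖ ^ 2 - γ (Ψ y')) * γ (Ψ y'))) y (J y))
    (neg_ne_zero.2 hlam) (hγpos _).ne'
  have hγ0 : γ (Ψ y) ≠ 0 := (hγpos _).ne'
  field_simp
  field_simp at h
  linear_combination h

/-- ★ **The Riemann law of `w₋` along an incoming characteristic** `Y'(ρ) = Y ρ + (λ/γ(Ψ))(Y ρ)·J(Y ρ)` at an exterior point
`Y ρ`. [folklore] -/
theorem riemann_law_neg_along_characteristic (hΨ : ContDiff ℝ 2 Ψ) (hγ : ContDiff ℝ 1 γ) (hγ' : ∀ r, HasDerivAt γ (γ' r) r)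
    (hJ : ∀ y' : EuclideanSpace ℝ (Fin 2), J y' = (-(y' 1)) • EuclideanSpace.single (0 : Fin 2) (1 : ℝ) +
      (y' 0) • EuclideanSpace.single (1 : Fin 2) (1 : ℝ))
    (hrot : ∀ y : EuclideanSpace ℝ (Fin 2),
      ω ^ 2 * fderiv ℝ (fun y' => fderiv ℝ Ψ y' (J y')) y (J y) =
        ∑ i, fderiv ℝ (fun y' => γ (Ψ y') * fderiv ℝ Ψ y' (EuclideanSpace.single i 1)) y (EuclideanSpace.single i 1))
    (hγpos : ∀ r, 0 < γ r) {ρ : ℝ}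
    (hY : HasDerivAt Y (Y ρ + (Real.sqrt ((ω ^ 2 * ‖Y ρ‖ ^ 2 - γ (Ψ (Y ρ))) * γ (Ψ (Y ρ))) / γ (Ψ (Y ρ))) • J (Y ρ)) ρ)
    (hext : γ (Ψ (Y ρ)) < ω ^ 2 * ‖Y ρ‖ ^ 2) :
    HasDerivAt (fun ρ' => (fun y' : EuclideanSpace ℝ (Fin 2) => γ (Ψ y') * fderiv ℝ Ψ y' y' -
        Real.sqrt ((ω ^ 2 * ‖y'‖ ^ 2 - γ (Ψ y')) * γ (Ψ y')) * fderiv ℝ Ψ y' (J y')) (Y ρ'))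
      (-(γ' (Ψ (Y ρ)) / 4 * (1 / Real.sqrt ((ω ^ 2 * ‖Y ρ‖ ^ 2 - γ (Ψ (Y ρ))) * γ (Ψ (Y ρ))) ^ 2 + 1 / γ (Ψ (Y ρ)) ^ 2)) * ((γ (Ψ (Y ρ)) * fderiv ℝ Ψ (Y ρ) (Y ρ)) - Real.sqrt ((ω ^ 2 * ‖Y ρ‖ ^ 2 - γ (Ψ (Y ρ))) * γ (Ψ (Y ρ))) * fderiv ℝ Ψ (Y ρ) (J (Y ρ))) ^ 2
        + γ' (Ψ (Y ρ)) / (2 * Real.sqrt ((ω ^ 2 * ‖Y ρ‖ ^ 2 - γ (Ψ (Y ρ))) * γ (Ψ (Y ρ))) ^ 2) * (((γ (Ψ (Y ρ)) * fderiv ℝ Ψ (Y ρ) (Y ρ)) - Real.sqrt ((ω ^ 2 * ‖Y ρ‖ ^ 2 - γ (Ψ (Y ρ))) * γ (Ψ (Y ρ))) * fderiv ℝ Ψ (Y ρ) (J (Y ρ))) * ((γ (Ψ (Y ρ)) * fderiv ℝ Ψ (Y ρ) (Y ρ)) + Real.sqrt ((ω ^ 2 * ‖Y ρ‖ ^ 2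 - γ (Ψ (Y ρ))) * γ (Ψ (Y ρ))) * fderiv ℝ Ψ (Y ρ) (J (Y ρ))))
        - γ' (Ψ (Y ρ)) / 4 * (1 / Real.sqrt ((ω ^ 2 * ‖Y ρ‖ ^ 2 - γ (Ψ (Y ρ))) * γ (Ψ (Y ρ))) ^ 2 - 1 / γ (Ψ (Y ρ)) ^ 2) * ((γ (Ψ (Y ρ)) * fderiv ℝ Ψ (Y ρ) (Y ρ)) + Real.sqrt ((ω ^ 2 * ‖Y ρ‖ ^ 2 - γ (Ψ (Y ρ))) * γ (Ψ (Y ρ))) * fderiv ℝ Ψ (Y ρ) (J (Y ρ))) ^ 2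
        + (fderiv ℝ (fun y' : EuclideanSpace ℝ (Fin 2) => Real.sqrt ((ω ^ 2 * ‖y'‖ ^ 2 - γ (Ψ y')) * γ (Ψ y'))) (Y ρ) (Y ρ) + Real.sqrt ((ω ^ 2 * ‖Y ρ‖ ^ 2 - γ (Ψ (Y ρ))) * γ (Ψ (Y ρ))) * fderiv ℝ (fun y' : EuclideanSpace ℝ (Fin 2) => Real.sqrt ((ω ^ 2 * ‖y'‖ ^ 2 - γ (Ψ y')) * γ (Ψ y'))) (Y ρ) (J (Y ρ)) / γ (Ψ (Y ρ))) / (2 * Real.sqrt ((ω ^ 2 * ‖Y ρ‖ ^ 2 - γ (Ψ (Y ρ))) * γ (Ψ (Y ρ)))) * (((γ (Ψ (Y ρ)) * fderiv ℝ Ψ (Y ρ) (Y ρ)) - Real.sqrt ((ω ^ 2 * ‖Y ρ‖ ^ 2 - γ (Ψ (Y ρ))) * γ (Ψ (Y ρ))) * fderiv ℝ Ψ (Y ρ) (J (Y ρ))) - ((γ (Ψ (Y ρ)) * fderiv ℝ Ψ (Y ρ) (Y ρ)) + Real.sqrt ((ω ^ 2 * ‖Y ρ‖ ^ 2 - γ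 (Ψ (Y ρ))) * γ (Ψ (Y ρ))) * fderiv ℝ Ψ (Y ρ) (J (Y ρ)))))
      ρ := by
  have h := hasDerivAt_comp_characteristic_neg (differentiableAt_incoming (ω := ω) hΨ hγ hJ hγpos (Y ρ) hext) hY
  rw [rotating_riemann_law_neg hΨ hγ hγ' hJ hrot hγpos (Y ρ) hext] at h
  exact h

end Summit.NavierStokesRegularity.NavierStokesRegularity.Theorems.PoloidalWindowDoorPoloidalWindowRigidityZShockRotatingProfileCharacteristicLaw
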